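import Summits.QuantumFields.YangMills.Theorems.UnitScaleTiltMinimiserStabilityRegPrResidueThree
import Summits.QuantumFields.YangMills.Theorems.UnitScaleTiltThm1GuardedFiveResidueThree
import HarnessLib

/-!
# Route `UnitScaleTilt` — THE RUNG LEAF OF RECORD `YM3TorusSU2` FROM {⟨EX body at L = 3⟩, `FluctuationComparisonRegPrIntL`, 19936's NODE-O row (O‴χₛ)}, BY NAME
# (★★OWNER g40 WORD №218 (A): docket (5)'s evidence made complete — the `L = 3` residue is ONE letter for the whole leaf)

Cell `ym3-torus` (YM ladder rung R3 = continuum `SU(2)` Yang–Mills on T³ — a RUNG, NOT d = 4, NOT infinite volume, NOT a mass gap, NOT Clay); seat `ym-line-cst-p1` g39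
(free prover hand); `--supports stmt-QuantumFields-19936 --as helper`, count-neutral, definition-free, default heartbeats; registry ∕ route ∕ display untouched.

WHAT.  The leaf of record `T3YM3TorusStatement.YM3TorusSU2` (ONE threshold `γ₁` for every family, every odd block size `L > 1`) is concluded in the tree only by the route's
glue `Theses/UnitScaleTilt.lean` `closes (h200 : MinimiserStabilityRegPr) (h201 : FluctuationComparisonRegPrIntL) (hK2 : HistoryTailL) : YM3TorusSU2` (`γ₁ := 1`).  After
✓p790882 (EX OUTRIGHT at `L ≥ 5`) two of its three binders are functions of ONE `L = 3` letter and 19936's one registered NODE-O row: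
* `h200` := ★p1 g30's ✓`MinimiserStabilityRegPrResidueThree.minimiserStabilityRegPr_of_exBody_three (hEX₃)` — the crux 19200 AS REGISTERED (all `L`) from ⟨EX body at `L = 3`⟩
  (`L ≥ 5` by ✓`minimiserStabilityRegPr_guarded_five`, `L = 3` by `cruxBody_of_exBody`, off-admissible block sizes vacuous);
* `hK2` := ✓`Thm1GuardedFiveResidueThree.historyTailL_of_existenceAtThree_selXsV4DataRows (hEX₃) (hrows)` — the crux 19936 AS REGISTERED from the same ⟨EX@3⟩ and its row
  `stub_selXsV4DataRows` (TYPE VERBATIM, every odd `L > 1`);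
* `h201` := the crux stmt-QuantumFields-20520 BY NAME.
Hence ★★★ `ym3TorusSU2_of_exBodyThree_intL_selXsV4DataRows (hEX₃) (h201) (hrows) : YM3TorusSU2` — ONE TERM (`closes ∘ …`); no per-block-size case split (both siblings are fed as
all-`L` statements); `.at L₀` gives every fixed-block leaf (print's admissible-block leaf from the same three inputs is ALREADY
✓`Thm1GuardedFiveResidueThree.ym3TorusSU2Adm_of_existenceAtThree_siblingRows` — not restated).  ANSWER to №218 (A): the `L₀ = 3` leaf needs 19200 at `3`, which ⟨EX@3⟩ gives
(★p1 §4) — NOTHING beyond {⟨EX@3⟩, 20520, the row} is read, and the uniform threshold is the route's `γ₁ = 1`.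

HONEST SCOPE (CREDIT NOTHING): a junction of landed theorems; ⟨EX body at `L = 3`⟩ (⟸ `hThm2S3` = [Balaban1985RegularSpaces] Thm 2 at `L = 3` by ✓p783315's chain; docket (5),
embargo-lite №58 — NOT attempted here), `FluctuationComparisonRegPrIntL` (20520), (O‴χₛ), hence `YM3TorusSU2`, are NOT proved; 19200 ∕ 19936 AS REGISTERED NOT proved; closes 0∕3;
rung R3 = SU(2) YM₃ on T³ — NOT d = 4, NOT infinite volume, NOT a mass gap, NOT Clay; the Yang–Mills mass gap is NOT proved.  Sorry-free, axioms standard.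

References: T. Bałaban, CMP **102** (1985) 255–275 [Balaban1985UV3] ((1)–(3) p.256, (67)–(71) p.273); CMP **102** (1985) 277–309 [Balaban1985Variational] (Thm 1 (8) p.279,
Prop. 7 p.299); CMP **109** (1987) 249–301 [Balaban1987RG1] (§0 p.251).
-/

set_option autoImplicit false

noncomputable section

namespace Summit.QuantumFields.YangMills.Theorems.YM3TorusSU2OfResidueThree

open MeasureTheory
open scoped Matrix.Norms.L2Operator
open Literature.MathematicalPhysics.QuantumFieldTheory.Balaban1983to89
open Literature.MathematicalPhysics.QuantumFieldTheory.Balaban1983to89.T3ContinuumYM3Torus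
open Literature.MathematicalPhysics.QuantumFieldTheory.Balaban1983to89.T3UnitLawDensityEML (ℰp)
open Literature.MathematicalPhysics.QuantumFieldTheory.Balaban1983to89.T3UnitScaleTilt
open Literature.MathematicalPhysics.QuantumFieldTheory.Balaban1983to89.T3TiltDescent
open Literature.MathematicalPhysics.QuantumFieldTheory.Balaban1983to89.T3PrintedRegularMinimiser
open Literature.MathematicalPhysics.QuantumFieldTheory.Balaban1983to89.T3PrintedMinimiserExistence (Thm1GlobalMinAt)
open Literature.MathematicalPhysics.QuantumFieldTheory.Balaban1983to89.T3ConstrainedMinimiser (fibre)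
open Literature.MathematicalPhysics.QuantumFieldTheory.Balaban1983to89.ExpMeanLog (deltaSU)
open Literature.MathematicalPhysics.QuantumFieldTheory.Balaban1983to89.T3YM3TorusStatement (YM3TorusSU2 YM3TorusSU2Adm YM3TorusSU2At)
open Literature.MathematicalPhysics.QuantumFieldTheory.Balaban1985CMP102
open Literature.MathematicalPhysics.QuantumFieldTheory.Balaban1985CMP102.Setting
open Summit.QuantumFields.Balaban3D.Carriers (suGroupModel)
open Summit.QuantumFields.Balaban3D.Proofs.Primitives (AlphaConsts)
open Summit.QuantumFields.Balaban3D.Proofs.Thresholds (Q0)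
open B7Prop2Explicit (C0)
open Summit.QuantumFields.YangMills.Theses.UnitScaleTilt (FluctuationComparisonRegPrIntL HistoryTailL closes)
open Summit.QuantumFields.YangMills.Theorems
open Summit.QuantumFields.YangMills.Theorems.MinimiserStabilityRegPrResidueThree (minimiserStabilityRegPr_of_exBody_three)
open Summit.QuantumFields.YangMills.Theorems.Thm1GuardedFiveResidueThree (historyTailL_of_existenceAtThree_selXsV4DataRows)

/-- ★★★ **THE RUNG LEAF OF RECORD FROM ONE `L = 3` LETTER, THE SIBLING CRUX 20520 AND 19936's NODE-O ROW**:
`YM3TorusSU2 ⟸ {⟨EX body at L = 3⟩, FluctuationComparisonRegPrIntL, ⟨stub_selXsV4DataRows, every odd L > 1⟩}` — the route's `closes` with `h200` fed by ★p1 g30's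
✓`minimiserStabilityRegPr_of_exBody_three` and `hK2` by ✓`historyTailL_of_existenceAtThree_selXsV4DataRows`; uniform `γ₁ = 1`.  CONDITIONAL on the three displayed inputs.
[cite: Balaban1985UV3, (1)-(3) p.256 and (67)–(71) p.273; Balaban1985Variational, Prop. 7 p.299; Balaban1987RG1, §0 p.251] -/
theorem ym3TorusSU2_of_exBodyThree_intL_selXsV4DataRows
    (hEX₃ : ∀ (B₃ : ℝ), 4 < B₃ → ∃ a₁' O₁ : ℝ, 0 < a₁' ∧ 1 ≤ O₁ ∧
      ∀ (F : T3Family), F.L = 3 → ∀ (n K : ℕ) (hnK : n < K) (ε₁ : ℝ), 0 < ε₁ →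
        ∀ V : GaugeField (F.P n) 0 (Matrix.specialUnitaryGroup (Fin 2) ℂ), PlaqSmall ε₁ V →
          ∀ U₀ : GaugeField (F.P K) 0 (Matrix.specialUnitaryGroup (Fin 2) ℂ), RegPr F n K (((3 : ℕ) : ℝ) ^ 3 * B₃ * ε₁) U₀ → U₀ ∈ fibre F ℰp n K hnK.le V →
            ε₁ ≤ a₁' → ∃ U ∈ regFibrePr F n K hnK.le (O₁ * ((3 : ℕ) : ℝ) ^ 3 * B₃ * ε₁) V,
              IsMinOn (fun W : GaugeField (F.P K) 0 (Matrix.specialUnitaryGroup (Fin 2) ℂ) => wilsonAction4 W)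
                (regFibrePr F n K hnK.le (O₁ * ((3 : ℕ) : ℝ) ^ 3 * B₃ * ε₁) V) U)
    (h201 : FluctuationComparisonRegPrIntL)
    (hrows : ∀ L : ℕ, Odd L → 1 < L → ∃ (B₀ A₀ A₁ : ℝ), 0 < A₀ ∧ 0 < A₁ ∧
      ∀ (B a₀ a₁ : ℝ), B₀ ≤ B → 1 ≤ 2 * B → 0 < a₀ → a₀ ≤ A₀ → 0 < a₁ → a₁ ≤ A₁ → B * a₁ ≤ a₀ →
        (143 * ((((3 + 4 : ℕ) : ℝ)) ^ 2 / 4) ^ 2) * (2 * (B * a₁)) ≤ 1 / 3 →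
        2 * (2 * (B * a₁)) ≤ 2 * deltaSU (Fin 2) / (((3 + 4) * L : ℕ) : ℝ) ^ 2 →
        Thm1GlobalMinAt L a₀ a₁ B →
        ∃ (b₁ p₁ : ℝ), ∀ (b₀ p₀ : ℝ), b₁ ≤ b₀ → p₁ ≤ p₀ →
          ∃ 𝔠 : AlphaConsts L (suGroupModel 2).N, 𝔠.b₀ = b₀ ∧ 𝔠.p₀ = p₀ ∧ 𝔠.B₃ = B ∧
            4 * 𝔠.B₃ * (L : ℝ) ^ 2 * avgWindowFactor L ≤ 𝔠.C68 ∧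
            Real.exp (𝔠.p₀ - 1) ≤ 3 * C0 3 * 𝔠.C68 * (𝔠.b₀ * Q0 𝔠.p₀) ∧
            (𝔠.b₀ * Q0 𝔠.p₀) * (2 * (L : ℝ) ^ 2 * avgWindowFactor L) ^ 2 ≤ 3 * C0 3 * 𝔠.C68 * a₁ ^ 2 ∧
            ∀ (F : T3Family) (hF : F.L = L),
              (∀ (γ : ℝ) (hγ : 0 < γ) (hγ1 : γ ≤ (min (hF ▸ 𝔠).gamma0 1) ^ 2) (K : ℕ),
                AlphaInputsT3AC.SmallFactor71OfRecT3 F (hF ▸ 𝔠) γ hγ hγ1 K) ∧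
              ∀ (γ : ℝ) (hγ : 0 < γ) (hγ1 : γ ≤ (min (hF ▸ 𝔠).gamma0 1) ^ 2) (K : ℕ),
                (∃ Ut : (k : ℕ) → GaugeField (F.P K) k (Matrix.specialUnitaryGroup (Fin 2) ℂ) →
                    GaugeField (F.P K) 0 (Matrix.specialUnitaryGroup (Fin 2) ℂ),
                  AlphaInputsT3AC.TrivMinimiserRowsT3 F (hF ▸ 𝔠) γ hγ hγ1 a₀ a₁ K Ut) →
                ∃ Ut : (k : ℕ) → GaugeField (F.P K) k (Matrix.specialUnitaryGroup (Fin 2) ℂ) →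
                    GaugeField (F.P K) 0 (Matrix.specialUnitaryGroup (Fin 2) ℂ),
                  AlphaInputsT3AC.TrivMinimiserRowsT3 F (hF ▸ 𝔠) γ hγ hγ1 a₀ a₁ K Ut ∧
                    AlphaInputsT3AC.DataRowsT3XsChiSel F (hF ▸ 𝔠) γ hγ hγ1 K Ut) :
    YM3TorusSU2 :=
  closes (minimiserStabilityRegPr_of_exBody_three hEX₃) h201 (historyTailL_of_existenceAtThree_selXsV4DataRows hEX₃ hrows)

/-- Every fixed-block leaf `YM3TorusSU2At L₀` from the same three inputs (lit ✓`YM3TorusSU2.at`; the companion ✓`…HistoryTailGuardedFive` serves `L₀ ≥ 5` WITHOUT the `L = 3` letter).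
[cite: Balaban1985UV3, (1)-(3) p.256] -/
theorem ym3TorusSU2At_of_exBodyThree_intL_selXsV4DataRows (L₀ : ℕ)
    (hEX₃ : ∀ (B₃ : ℝ), 4 < B₃ → ∃ a₁' O₁ : ℝ, 0 < a₁' ∧ 1 ≤ O₁ ∧
      ∀ (F : T3Family), F.L = 3 → ∀ (n K : ℕ) (hnK : n < K) (ε₁ : ℝ), 0 < ε₁ →
        ∀ V : GaugeField (F.P n) 0 (Matrix.specialUnitaryGroup (Fin 2) ℂ), PlaqSmall ε₁ V →
          ∀ U₀ : GaugeField (F.P K) 0 (Matrix.specialUnitaryGroup (Fin 2) ℂ), RegPr F n K (((3 : ℕ) : ℝ) ^ 3 * B₃ * ε₁) U₀ → U₀ ∈ fibre F ℰp n K hnK.le V →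
            ε₁ ≤ a₁' → ∃ U ∈ regFibrePr F n K hnK.le (O₁ * ((3 : ℕ) : ℝ) ^ 3 * B₃ * ε₁) V,
              IsMinOn (fun W : GaugeField (F.P K) 0 (Matrix.specialUnitaryGroup (Fin 2) ℂ) => wilsonAction4 W)
                (regFibrePr F n K hnK.le (O₁ * ((3 : ℕ) : ℝ) ^ 3 * B₃ * ε₁) V) U)
    (h201 : FluctuationComparisonRegPrIntL)
    (hrows : ∀ L : ℕ, Odd L → 1 < L → ∃ (B₀ A₀ A₁ : ℝ), 0 < A₀ ∧ 0 < A₁ ∧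
      ∀ (B a₀ a₁ : ℝ), B₀ ≤ B → 1 ≤ 2 * B → 0 < a₀ → a₀ ≤ A₀ → 0 < a₁ → a₁ ≤ A₁ → B * a₁ ≤ a₀ →
        (143 * ((((3 + 4 : ℕ) : ℝ)) ^ 2 / 4) ^ 2) * (2 * (B * a₁)) ≤ 1 / 3 →
        2 * (2 * (B * a₁)) ≤ 2 * deltaSU (Fin 2) / (((3 + 4) * L : ℕ) : ℝ) ^ 2 →
        Thm1GlobalMinAt L a₀ a₁ B →
        ∃ (b₁ p₁ : ℝ), ∀ (b₀ p₀ : ℝ), b₁ ≤ b₀ → p₁ ≤ p₀ →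
          ∃ 𝔠 : AlphaConsts L (suGroupModel 2).N, 𝔠.b₀ = b₀ ∧ 𝔠.p₀ = p₀ ∧ 𝔠.B₃ = B ∧
            4 * 𝔠.B₃ * (L : ℝ) ^ 2 * avgWindowFactor L ≤ 𝔠.C68 ∧
            Real.exp (𝔠.p₀ - 1) ≤ 3 * C0 3 * 𝔠.C68 * (𝔠.b₀ * Q0 𝔠.p₀) ∧
            (𝔠.b₀ * Q0 𝔠.p₀) * (2 * (L : ℝ) ^ 2 * avgWindowFactor L) ^ 2 ≤ 3 * C0 3 * 𝔠.C68 * a₁ ^ 2 ∧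
            ∀ (F : T3Family) (hF : F.L = L),
              (∀ (γ : ℝ) (hγ : 0 < γ) (hγ1 : γ ≤ (min (hF ▸ 𝔠).gamma0 1) ^ 2) (K : ℕ),
                AlphaInputsT3AC.SmallFactor71OfRecT3 F (hF ▸ 𝔠) γ hγ hγ1 K) ∧
              ∀ (γ : ℝ) (hγ : 0 < γ) (hγ1 : γ ≤ (min (hF ▸ 𝔠).gamma0 1) ^ 2) (K : ℕ),
                (∃ Ut : (k : ℕ) → GaugeField (F.P K) k (Matrix.specialUnitaryGroup (Fin 2) ℂ) →
                    GaugeField (F.P K) 0 (Matrix.specialUnitaryGroup (Fin 2) ℂ),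
                  AlphaInputsT3AC.TrivMinimiserRowsT3 F (hF ▸ 𝔠) γ hγ hγ1 a₀ a₁ K Ut) →
                ∃ Ut : (k : ℕ) → GaugeField (F.P K) k (Matrix.specialUnitaryGroup (Fin 2) ℂ) →
                    GaugeField (F.P K) 0 (Matrix.specialUnitaryGroup (Fin 2) ℂ),
                  AlphaInputsT3AC.TrivMinimiserRowsT3 F (hF ▸ 𝔠) γ hγ hγ1 a₀ a₁ K Ut ∧
                    AlphaInputsT3AC.DataRowsT3XsChiSel F (hF ▸ 𝔠) γ hγ hγ1 K Ut) :
    YM3TorusSU2At L₀ :=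
  (ym3TorusSU2_of_exBodyThree_intL_selXsV4DataRows hEX₃ h201 hrows).at L₀

end Summit.QuantumFields.YangMills.Theorems.YM3TorusSU2OfResidueThree

end
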